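import Summits.Ventures.PercRepro.ProfilePointedCircuitClassesFiveTwo

/-!
# PercRepro — THE PER-CIRCUIT CLASS IS A THRU-COUNT ONE NULLITY DOWN: THE REDUCTION `(x, C) ⇔ (A_{C − w})`
(p5, gen 37; `proofs/P5-GM1.md` §53(a), in the kernel for EVERY circuit and EVERY level)

For a circuit `C + x` of `N` (`C` independent, `x ∈ cl C`, `x ∉ cl(C − c)` for every `c ∈ C`) and any `w ∈ C`, the
class of `(x, C)` at the level `k` — the bi-independent `k`-sets `W ⊇ C` avoiding `x` — is in bijection (`W ↦ W − w`)
with the bi-independent `(k − 1)`-sets of the minor `N° := N ／ x ∖ w` CONTAINING `S := C − w`: every `c ∈ C` lies in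
`cl((C − c) + x)`, so `ρ_N(X + x) = ρ_N(X + w)` for every `X ⊇ S`, and `W` is bi-independent in `N` iff `W − w` is
bi-independent in `N°`.  Hence `γ_C(k) = thru^{N°}_{k−1}(S)` (`gammaC_eq_thruCount_contract_delete`), and the
per-circuit claim `γ_C(k) ≤ γ_C(n − 1 − k)` IS the per-set refinement `thru_{k−1}(S) ≤ thru_{n° − k}(S)` of Theorem A's
step on `N°` (`gammaC_le_iff_thruCount_le`); for `#C = 1` it is the weak step `P_{k−1} ≤ P_{n°−k}` (the kernel's bridge,
`ProfilePointedCircuitClassesOne` / `FiveOne`), for `#C = 2` the per-point in–out inequality (`FiveTwo`).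
-/

open scoped Matroid

namespace PercRepro.Cogirth

open Finset ThmH Skew Shadow Profile

variable {α : Type} [DecidableEq α] {N : Matroid α} [N.Finite]

section Reduction

/-- In a circuit `C + x` (`C` independent, `x ∈ cl C`, `x ∉ cl(C − c)`), every `c ∈ C` lies in `cl((C − c) + x)`:
`ρ((C − c) + x) = #C = ρ(C) = ρ(C + x)`. -/
theorem mem_clF_insert_erase_of_circuit {x : α} {C : Finset α} (hC : C ⊆ gr N) (hx : x ∈ gr N)
    (hrk : rk N C = C.card) (hxcl : x ∈ clF N C) {c : α} (hc : c ∈ C) (hcf : x ∉ clF N (C.erase c)) :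
    c ∈ clF N (insert x (C.erase c)) := by
  by_contra h
  have hCe : C.erase c ⊆ gr N := (erase_subset c C).trans hC
  have r1 : rk N (insert x (C.erase c)) = rk N (C.erase c) + 1 := by
    rw [rk_insert_eq hx hCe, if_neg hcf]
  have r2 : rk N (insert c (insert x (C.erase c))) = rk N (insert x (C.erase c)) + 1 := by
    rw [rk_insert_eq (hC hc) (insert_subset hx hCe), if_neg h]
  have e : insert c (insert x (C.erase c)) = insert x C := by
    ext a
    simp only [mem_insert, mem_erase]
    constructor
    · rintro (rfl | rfl | ⟨_, h⟩)
      · exact Or.inr hc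
      · exact Or.inl rfl
      · exact Or.inr h
    · rintro (rfl | h)
      · exact Or.inr (Or.inl rfl)
      · by_cases hac : a = c
        · exact Or.inl hac
        · exact Or.inr (Or.inr ⟨hac, h⟩)
  have r3 : rk N (insert x C) = rk N C := by rw [rk_insert_eq hx hC, if_pos hxcl]
  have rCe : rk N (C.erase c) = C.card - 1 := by
    rw [rk_eq_card_of_subset_of_rk_eq_card (erase_subset c C) hrk, card_erase_of_mem hc]
  have h1 : 1 ≤ C.card := card_pos.2 ⟨c, hc⟩
  rw [e, r3, r1, rCe, hrk] at r2
  omega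

/-- **THE CLASS OF A CIRCUIT AT EVERY LEVEL**: for a circuit `C + x` and a bi-independent `W`, `W` is a captured set of the
class `C` iff `C ⊆ W` and `x ∉ W`. -/
theorem class_iff_of_circuit {x : α} {C : Finset α} (hC : C ⊆ gr N) (hx : x ∈ gr N) (hrk : rk N C = C.card)
    (hxcl : x ∈ clF N C) (hfund : ∀ c ∈ C, x ∉ clF N (C.erase c)) {k : ℕ} {W : Finset α}
    (hW : W ∈ biIndepSets N k) :
    (x ∉ W ∧ x ∈ clF N W ∧ fundC N W x = C) ↔ (C ⊆ W ∧ x ∉ W) := by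
  rw [mem_biIndepSets] at hW
  obtain ⟨hWg, _, hWrk, _⟩ := hW
  constructor
  · rintro ⟨hxW, _, hf⟩
    exact ⟨hf ▸ fundC_subset W x, hxW⟩
  · rintro ⟨hCW, hxW⟩
    have hxclW : x ∈ clF N W := mem_clF_of_subset hCW hxcl
    refine ⟨hxW, hxclW, ?_⟩
    ext c
    unfold fundC
    rw [mem_filter]
    constructor
    · rintro ⟨hcW, hx'⟩
      by_contra hcC
      have hsub : C ⊆ W.erase c := by
        intro a ha
        rw [mem_erase]
        exact ⟨fun h => hcC (h ▸ ha), hCW ha⟩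
      exact hx' (mem_clF_of_subset hsub hxcl)
    · intro hcC
      refine ⟨hCW hcC, ?_⟩
      intro hx'
      have hWe : W.erase c ⊆ gr N := (erase_subset c W).trans hWg
      have hccl : c ∈ clF N (insert x (C.erase c)) :=
        mem_clF_insert_erase_of_circuit hC hx hrk hxcl hcC (hfund c hcC)
      have hsub : insert x (C.erase c) ⊆ insert x (W.erase c) := by
        intro a ha
        rw [mem_insert, mem_erase] at ha
        rw [mem_insert, mem_erase]
        rcases ha with rfl | ⟨hac, haC⟩
        · exact Or.inl rfl
        · exact Or.inr ⟨hac, hCW haC⟩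
      have hccl' : c ∈ clF N (insert x (W.erase c)) := mem_clF_of_subset hsub hccl
      have r1 : rk N (insert x (W.erase c)) = rk N (W.erase c) := by
        rw [rk_insert_eq hx hWe, if_pos hx']
      have r2 : rk N (insert c (insert x (W.erase c))) = rk N (insert x (W.erase c)) := by
        rw [rk_insert_eq (hWg (hCW hcC)) (insert_subset hx hWe), if_pos hccl']
      have e : insert c (insert x (W.erase c)) = insert x W := by
        ext a
        simp only [mem_insert, mem_erase]
        constructor
        · rintro (rfl | rfl | ⟨_, h⟩)
          · exact Or.inr (hCW hcC)
          · exact Or.inl rfl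
          · exact Or.inr h
        · rintro (rfl | h)
          · exact Or.inr (Or.inl rfl)
          · by_cases hac : a = c
            · exact Or.inl hac
            · exact Or.inr (Or.inr ⟨hac, h⟩)
      have r3 : rk N (insert x W) = rk N W := by rw [rk_insert_eq hx hWg, if_pos hxclW]
      have rWe : rk N (W.erase c) = W.card - 1 := by
        rw [rk_eq_card_of_subset_of_rk_eq_card (erase_subset c W) hWrk, card_erase_of_mem (hCW hcC)]
      have hW1 : 1 ≤ W.card := card_pos.2 ⟨c, hCW hcC⟩
      rw [e, r3, r1, rWe, hWrk] at r2
      omega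

/-- **THE REDUCTION** (§53(a)): for a circuit `C + x` and `w ∈ C`, the class of `(x, C)` at the level `k ≥ 1` has exactly as
many members as there are bi-independent `(k − 1)`-sets of `N ／ x ∖ w` containing `C − w`
(`W ↦ W − w`, inverse `X ↦ X + w`). -/
theorem gammaC_eq_thruCount_contract_delete {x : α} {C : Finset α} (hC : C ⊆ gr N) (hx : x ∈ gr N)
    (hxC : x ∉ C) (hrk : rk N C = C.card) (hxcl : x ∈ clF N C) (hfund : ∀ c ∈ C, x ∉ clF N (C.erase c))
    {w : α} (hw : w ∈ C) {k : ℕ} (hk : 1 ≤ k) :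
    gammaC N k x C = thruCount ((N ／ ({x} : Set α)) ＼ ({w} : Set α)) (k - 1) (C.erase w) := by
  have hwg : w ∈ gr N := hC hw
  have hxw : x ≠ w := fun h => hxC (h ▸ hw)
  have hSg : C.erase w ⊆ gr N := (erase_subset w C).trans hC
  have hwcl : w ∈ clF N (insert x (C.erase w)) :=
    mem_clF_insert_erase_of_circuit hC hx hrk hxcl hw (hfund w hw)
  have hx1 : rk N {x} = 1 := by
    have h := rk_insert_eq hx (empty_subset (gr N)) (M := N)
    rw [insert_empty] at h
    have hxe : x ∉ clF N ∅ := by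
      intro h0
      exact hfund w hw (mem_clF_of_subset (empty_subset _) h0)
    rw [if_neg hxe] at h
    have h0 : rk N ∅ = 0 := Nat.le_zero.1 ((rk_le_card (M := N) ∅).trans (by rw [card_empty]))
    omega
  have hxind : N.Indep ({x} : Set α) := by
    have := indep_of_rk_eq_card' (M := N) (X := {x}) (by rw [hx1, card_singleton])
    simpa using this
  have hgr₀ : gr ((N ／ ({x} : Set α)) ＼ ({w} : Set α)) = ((gr N).erase x).erase w := by
    rw [gr_delete', gr_contract']
  have hrk₀ : ∀ X : Finset α, X ⊆ ((gr N).erase x).erase w →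
      rk ((N ／ ({x} : Set α)) ＼ ({w} : Set α)) X + 1 = rk N (insert x X) := by
    intro X hX
    have hX' : X ⊆ (gr (N ／ ({x} : Set α))).erase w := by rw [gr_contract']; exact hX
    have hX'' : X ⊆ (gr N).erase x := hX.trans (erase_subset _ _)
    rw [rk_delete hX', rk_contract_add_one hxind hX'']
  unfold gammaC thruCount
  rw [filter_congr (fun W hW => class_iff_of_circuit hC hx hrk hxcl hfund hW)]
  apply card_nbij' (fun W => W.erase w) (fun X => insert w X)
  · intro W hW
    rw [mem_coe, mem_filter, mem_biIndepSets] at hW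
    obtain ⟨⟨hWg, hWcard, hWrk, hWcompl⟩, hCW, hxW⟩ := hW
    have hwW : w ∈ W := hCW hw
    rw [mem_coe, mem_filter, mem_biIndepSets, hgr₀]
    simp only
    have hWeg : W.erase w ⊆ ((gr N).erase x).erase w := by
      intro a ha
      rw [mem_erase] at ha
      exact mem_erase.2 ⟨ha.1, mem_erase.2 ⟨fun h => hxW (h ▸ ha.2), hWg ha.2⟩⟩
    have hSW : C.erase w ⊆ W.erase w := by
      intro a ha
      rw [mem_erase] at ha ⊢
      exact ⟨ha.1, hCW ha.2⟩
    refine ⟨⟨hWeg, ?_, ?_, ?_⟩, hSW⟩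
    · rw [card_erase_of_mem hwW, hWcard]
    · have h := hrk₀ (W.erase w) hWeg
      have hwcl' : w ∈ clF N (insert x (W.erase w)) :=
        mem_clF_of_subset (insert_subset_insert x hSW) hwcl
      have r1 : rk N (insert w (insert x (W.erase w))) = rk N (insert x (W.erase w)) := by
        rw [rk_insert_eq hwg (insert_subset hx ((erase_subset _ _).trans hWg)), if_pos hwcl']
      have e : insert w (insert x (W.erase w)) = insert x W := by
        ext a
        simp only [mem_insert, mem_erase]
        constructor
        · rintro (rfl | rfl | ⟨_, h⟩)
          · exact Or.inr hwW
          · exact Or.inl rfl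
          · exact Or.inr h
        · rintro (rfl | h)
          · exact Or.inr (Or.inl rfl)
          · by_cases haw : a = w
            · exact Or.inl haw
            · exact Or.inr (Or.inr ⟨haw, h⟩)
      have r3 : rk N (insert x W) = rk N W := by
        rw [rk_insert_eq hx hWg, if_pos (mem_clF_of_subset hCW hxcl)]
      rw [e, r3, hWrk] at r1
      rw [card_erase_of_mem hwW]
      omega
    · have e : ((gr N).erase x).erase w \ W.erase w = (gr N \ W).erase x := by
        ext a
        simp only [mem_sdiff, mem_erase]
        constructor
        · rintro ⟨⟨haw, hax, hag⟩, h⟩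
          exact ⟨hax, hag, fun haW => h ⟨haw, haW⟩⟩
        · rintro ⟨hax, hag, haW⟩
          exact ⟨⟨fun h => haW (h ▸ hwW), hax, hag⟩, fun h => haW h.2⟩
      rw [e]
      have hYg : (gr N \ W).erase x ⊆ ((gr N).erase x).erase w := by rw [← e]; exact sdiff_subset
      have h := hrk₀ _ hYg
      have eY : insert x ((gr N \ W).erase x) = gr N \ W := insert_erase (mem_sdiff.2 ⟨hx, hxW⟩)
      rw [eY, hWcompl] at h
      have : 0 < (gr N \ W).card := card_pos.2 ⟨x, mem_sdiff.2 ⟨hx, hxW⟩⟩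
      rw [card_erase_of_mem (mem_sdiff.2 ⟨hx, hxW⟩)]
      omega
  · intro X hX
    rw [mem_coe, mem_filter, mem_biIndepSets, hgr₀] at hX
    obtain ⟨⟨hXg, hXcard, hXrk, hXcompl⟩, hSX⟩ := hX
    have hwX : w ∉ X := fun h => (mem_erase.1 (hXg h)).1 rfl
    have hxX : x ∉ X := fun h => (mem_erase.1 (mem_erase.1 (hXg h)).2).1 rfl
    have hXg' : X ⊆ gr N := hXg.trans ((erase_subset _ _).trans (erase_subset _ _))
    have hCX : C ⊆ insert w X := by
      intro a ha
      rw [mem_insert]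
      by_cases haw : a = w
      · exact Or.inl haw
      · exact Or.inr (hSX (mem_erase.2 ⟨haw, ha⟩))
    rw [mem_coe, mem_filter, mem_biIndepSets]
    simp only
    refine ⟨⟨insert_subset hwg hXg', ?_, ?_, ?_⟩, hCX, ?_⟩
    · rw [card_insert_of_notMem hwX, hXcard]
      omega
    · have h := hrk₀ X hXg
      rw [hXrk, hXcard] at h
      have hxcl' : x ∈ clF N (insert w X) := mem_clF_of_subset hCX hxcl
      have hwcl' : w ∈ clF N (insert x X) := mem_clF_of_subset (insert_subset_insert x hSX) hwcl
      have r1 : rk N (insert x (insert w X)) = rk N (insert w X) := by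
        rw [rk_insert_eq hx (insert_subset hwg hXg'), if_pos hxcl']
      have r2 : rk N (insert w (insert x X)) = rk N (insert x X) := by
        rw [rk_insert_eq hwg (insert_subset hx hXg'), if_pos hwcl']
      have e : insert x (insert w X) = insert w (insert x X) := by
        ext a; simp only [mem_insert]; tauto
      rw [e, r2] at r1
      rw [card_insert_of_notMem hwX, ← r1]
      omega
    · have e : gr N \ insert w X = insert x (((gr N).erase x).erase w \ X) := by
        ext a
        simp only [mem_sdiff, mem_insert, mem_erase, not_or]
        constructor
        · rintro ⟨hag, haw, haX⟩
          by_cases hax : a = x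
          · exact Or.inl hax
          · exact Or.inr ⟨⟨haw, hax, hag⟩, haX⟩
        · rintro (rfl | ⟨⟨haw, hax, hag⟩, haX⟩)
          · exact ⟨hx, hxw, hxX⟩
          · exact ⟨hag, haw, haX⟩
      rw [e]
      have hYg : ((gr N).erase x).erase w \ X ⊆ ((gr N).erase x).erase w := sdiff_subset
      have h := hrk₀ _ hYg
      have hxY : x ∉ ((gr N).erase x).erase w \ X :=
        fun h => (mem_erase.1 (mem_erase.1 (mem_sdiff.1 h).1).2).1 rfl
      rw [hXcompl] at h
      rw [card_insert_of_notMem hxY]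
      omega
    · exact fun h => hxX ((mem_insert.1 h).resolve_left hxw)
  · intro W hW
    rw [mem_coe, mem_filter] at hW
    exact insert_erase (hW.2.1 hw)
  · intro X hX
    rw [mem_coe, mem_filter, mem_biIndepSets, hgr₀] at hX
    have hwX : w ∉ X := fun h => (mem_erase.1 (hX.1.1 h)).1 rfl
    exact erase_insert hwX

/-- **THE PER-CIRCUIT CLAIM IS THE PER-SET REFINEMENT ONE NULLITY DOWN**: for a circuit `C + x`, `w ∈ C` and
`1 ≤ k ≤ n − 2`, `γ_C(k) ≤ γ_C(n − 1 − k)` iff `thru_{k−1}(C − w) ≤ thru_{(n−2) − k}(C − w)` on `N ／ x ∖ w`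
(the two mirror levels of the minor on `n − 2` points). -/
theorem gammaC_le_iff_thruCount_le {x : α} {C : Finset α} (hC : C ⊆ gr N) (hx : x ∈ gr N)
    (hxC : x ∉ C) (hrk : rk N C = C.card) (hxcl : x ∈ clF N C) (hfund : ∀ c ∈ C, x ∉ clF N (C.erase c))
    {w : α} (hw : w ∈ C) {k : ℕ} (hk : 1 ≤ k) (hkn : k + 2 ≤ (gr N).card) :
    (gammaC N k x C ≤ gammaC N ((gr N).card - 1 - k) x C ↔
      thruCount ((N ／ ({x} : Set α)) ＼ ({w} : Set α)) (k - 1) (C.erase w) ≤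
        thruCount ((N ／ ({x} : Set α)) ＼ ({w} : Set α)) ((gr N).card - 2 - k) (C.erase w)) := by
  rw [gammaC_eq_thruCount_contract_delete hC hx hxC hrk hxcl hfund hw hk,
    gammaC_eq_thruCount_contract_delete hC hx hxC hrk hxcl hfund hw (by omega)]
  have e : (gr N).card - 1 - k - 1 = (gr N).card - 2 - k := by omega
  rw [e]

end Reduction

end PercRepro.Cogirth
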